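import Literature.Topology.FourManifolds.NormalRetraction
import Literature.Topology.FourManifolds.InteriorManifold
import Literature.Geometry.Manifold.ModelChange
import Mathlib.Geometry.Manifold.WhitneyEmbedding
import Mathlib.Analysis.InnerProductSpace.EuclideanDist
import Mathlib.Topology.MetricSpace.Thickening
import Mathlib.Topology.ContinuousMap.Compact
import Mathlib.Topology.Homotopy.Basic
import HarnessLib

/-!
# Homotopy classes of maps into a compact manifold are open (topic `Geometry/Manifold`)

For a compact space `X` and a compact Hausdorff `C^∞` manifold `N` without boundary, every map
`ψ : C(X, N)` close enough to `f` in the compact-open topology is homotopic to `f`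
(`ContinuousMap.eventually_homotopic`): with a Whitney embedding `e : N → ℝᴷ` and a smooth
normal retraction `r` of a tube `T ⊇ e(N)` (Lee 2013, Prop. 6.25), maps `ψ` with
`sup dist(e ∘ ψ, e ∘ f)` below the tube margin are joined to `f` by the retracted straight-line
homotopy `r((1 − t) e f + t e ψ)` (Lee 2013, proof of Thm. 6.26 / Prop. 6.25 ff.; Hirsch 1976,
Ch. 4 §5). Consequently homotopy classes are open (and closed) in `C(X, N)`, and **a limit in
`C(X, N)` of maps homotopic to `f` is homotopic to `f`** (`ContinuousMap.Homotopic.of_tendsto`) —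
the topological step by which a convergent heat flow or approximation scheme produces a map in
the prescribed homotopy class (first consumer: the Eells–Sampson theorem,
`Literature/Geometry/Riemannian/EellsSampson.lean`). The target may carry any model with corners
on a finite-dimensional space provided it has no boundary points; the reduction to targets
charted on `ℝⁿ` is the identity recharting of `WhitneyApproximation.lean`.

Everything is proved; there are no definitions and no named facts.

## References

* J. M. Lee, *Introduction to Smooth Manifolds*, 2nd ed., GTM 218 (2013), Prop. 6.25, Thm. 6.26.
  [LeeSmoothManifolds2013]
* M. W. Hirsch, *Differential Topology*, GTM 33 (1976), Ch. 4 §5. [HirschDT1976]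
-/

open scoped Manifold ContDiff Topology
open Function Set Filter

noncomputable section

namespace Literature.Geometry.Manifold

open Literature.Topology.FourManifolds

/-! ### Targets charted on `ℝⁿ` -/

/-- **Nearby maps into a compact manifold charted on `ℝⁿ` are homotopic** (Lee 2013, Prop. 6.25
and the proof of Thm. 6.26): for `X` compact and `V` a compact Hausdorff `C^∞` manifold charted
on `EuclideanSpace ℝ (Fin n)`, every `ψ` in a neighbourhood of `f` in `C(X, V)` is homotopic to
`f` (retracted straight-line homotopy in a tubular neighbourhood of a Whitney embedding).
[cite: LeeSmoothManifolds2013, Prop. 6.25] -/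
theorem eventually_homotopic_of_chartedSpace_euclideanSpace
    {X : Type*} [TopologicalSpace X] [CompactSpace X]
    {n : ℕ} {V : Type*} [TopologicalSpace V] [ChartedSpace (EuclideanSpace ℝ (Fin n)) V]
    [IsManifold (𝓡 n) ∞ V] [CompactSpace V] [T2Space V] (f : C(X, V)) :
    ∀ᶠ ψ in 𝓝 f, ψ.Homotopic f := by
  rcases isEmpty_or_nonempty X with hX | hX
  · exact Eventually.of_forall fun ψ ↦
      ⟨ContinuousMap.Homotopy.refl ψ |>.cast rfl (by ext x; exact (IsEmpty.false x).elim)⟩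
  haveI : Nonempty V := ⟨f (Classical.arbitrary X)⟩
  -- ### Whitney embedding of `V` and a smooth normal retraction
  obtain ⟨N, e, he, hemb, hinj⟩ := exists_embedding_euclidean_of_compact (I := 𝓡 n) (M := V)
  obtain ⟨ε, hε, hTopen, hr, hre⟩ := exists_normalRetraction (I := 𝓡 n) he hemb.injective hinj
  set T := normalTube (𝓡 n) e ε with hTdef
  set r := normalRetraction (𝓡 n) e ε with hrdef
  have hreT : ∀ y : V, e y ∈ T ∧ r (e y) = y := fun y => by
    simpa [hTdef, hrdef] using hre y 0 (Submodule.zero_mem _) (by simpa using hε)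
  obtain ⟨δ, hδ, hδT⟩ := (isCompact_range he.continuous).exists_cthickening_subset_open hTopen
    (range_subset_iff.2 fun y => (hreT y).1)
  -- ### the neighbourhood: maps `δ`-close to `f` after embedding
  set E : C(V, EuclideanSpace ℝ (Fin N)) := ⟨e, he.continuous⟩ with hE
  have hopen : IsOpen ((fun ψ : C(X, V) ↦ E.comp ψ) ⁻¹' Metric.ball (E.comp f) δ) :=
    (ContinuousMap.continuous_postcomp E).isOpen_preimage _ Metric.isOpen_ball
  have hmem : f ∈ (fun ψ : C(X, V) ↦ E.comp ψ) ⁻¹' Metric.ball (E.comp f) δ := by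
    simp only [mem_preimage, Metric.mem_ball, dist_self]; exact hδ
  filter_upwards [hopen.mem_nhds hmem] with ψ hψ
  have hψ' : dist (E.comp ψ) (E.comp f) < δ := by simpa only [mem_preimage, Metric.mem_ball] using hψ
  have hψx : ∀ x, dist (e (ψ x)) (e (f x)) < δ := fun x ↦
    (ContinuousMap.dist_lt_iff hδ).1 hψ' x
  -- ### the segments from `e (f x)` to `e (ψ x)` stay in the tube
  have hseg : ∀ s : ℝ, s ∈ Icc (0 : ℝ) 1 → ∀ x : X, e (f x) + s • (e (ψ x) - e (f x)) ∈ T := by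
    intro s hs x
    apply hδT
    refine Metric.mem_cthickening_of_dist_le _ (e (f x)) _ _ ⟨f x, rfl⟩ ?_
    rw [dist_eq_norm, add_sub_cancel_left, norm_smul, Real.norm_eq_abs, abs_of_nonneg hs.1]
    calc s * ‖e (ψ x) - e (f x)‖ ≤ 1 * ‖e (ψ x) - e (f x)‖ := by gcongr; exact hs.2
      _ = dist (e (ψ x)) (e (f x)) := by rw [one_mul, dist_eq_norm]
      _ ≤ δ := (hψx x).le
  have hHc : Continuous fun q : unitInterval × X =>
      r (e (f q.2) + (q.1 : ℝ) • (e (ψ q.2) - e (f q.2))) := by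
    refine hr.continuousOn.comp_continuous ?_ fun q => hseg q.1 ⟨q.1.2.1, q.1.2.2⟩ q.2
    have h1 : Continuous fun q : unitInterval × X => e (f q.2) :=
      he.continuous.comp (f.continuous.comp continuous_snd)
    have h2 : Continuous fun q : unitInterval × X => e (ψ q.2) :=
      he.continuous.comp (ψ.continuous.comp continuous_snd)
    exact h1.add ((continuous_subtype_val.comp continuous_fst).smul (h2.sub h1))
  -- ### the retracted straight-line homotopy from `f` to `ψ`
  refine ContinuousMap.Homotopic.symm ⟨?_⟩
  exact
    { toFun := fun q : unitInterval × X => r (e (f q.2) + (q.1 : ℝ) • (e (ψ q.2) - e (f q.2)))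
      continuous_toFun := hHc
      map_zero_left := fun x => by
        change r (e (f x) + ((0 : unitInterval) : ℝ) • (e (ψ x) - e (f x))) = f x
        rw [Set.Icc.coe_zero, zero_smul, add_zero]
        exact (hreT (f x)).2
      map_one_left := fun x => by
        change r (e (f x) + ((1 : unitInterval) : ℝ) • (e (ψ x) - e (f x))) = ψ x
        rw [Set.Icc.coe_one, one_smul, add_sub_cancel]
        exact (hreT (ψ x)).2 }

/-! ### Targets with an arbitrary model with corners, without boundary -/

/-- **Nearby maps into a compact manifold without boundary are homotopic** (homotopy classes are
open in `C(X, N)`; Lee 2013, Prop. 6.25 / Thm. 6.26): `X` compact, `N` a compact Hausdorff `C^∞`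
manifold over any model with corners on a finite-dimensional space, without boundary points.
(Reduction to the `ℝⁿ`-charted case along the identity homeomorphism
`N ≅ Rechart toEuclidean (InteriorManifold IN N)` of `WhitneyApproximation.lean`.)
[cite: LeeSmoothManifolds2013, Prop. 6.25] -/
theorem eventually_homotopic
    {X : Type*} [TopologicalSpace X] [CompactSpace X]
    {EN HN : Type*} [NormedAddCommGroup EN] [NormedSpace ℝ EN] [FiniteDimensional ℝ EN]
    [TopologicalSpace HN] {IN : ModelWithCorners ℝ EN HN} {N : Type*} [TopologicalSpace N]
    [ChartedSpace HN N] [IsManifold IN ∞ N] [BoundarylessManifold IN N] [CompactSpace N]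
    [T2Space N] (f : C(X, N)) :
    ∀ᶠ ψ in 𝓝 f, ψ.Homotopic f := by
  -- ### `N` is its own interior, a manifold charted on `EN`, recharted on `ℝ^{dim EN}`
  let Φ : N ≃ₜ InteriorManifold IN N :=
    { toFun := fun x => ⟨x, BoundarylessManifold.isInteriorPoint (I := IN)⟩
      invFun := InteriorManifold.val
      left_inv := fun _ => rfl
      right_inv := fun _ => rfl
      continuous_toFun := InteriorManifold.continuous_iff_comp_val.2 continuous_id
      continuous_invFun := InteriorManifold.continuous_val }
  haveI : CompactSpace (InteriorManifold IN N) := Φ.compactSpace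
  let L : EN ≃L[ℝ] EuclideanSpace ℝ (Fin (Module.finrank ℝ EN)) := toEuclidean
  have hIf : ∀ x : EN, L.toHomeomorph x = L (𝓘(ℝ, EN) x) := fun x => rfl
  have hL : ContMDiff 𝓘(ℝ, EN) 𝓘(ℝ, EuclideanSpace ℝ (Fin (Module.finrank ℝ EN))) ∞
      L.toHomeomorph :=
    Rechart.contMDiff_of_apply_eq_linear (I := 𝓘(ℝ, EN)) L.toHomeomorph L hIf
  have hL' : ContMDiff 𝓘(ℝ, EuclideanSpace ℝ (Fin (Module.finrank ℝ EN))) 𝓘(ℝ, EN) ∞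
      L.toHomeomorph.symm :=
    Rechart.contMDiff_symm_of_apply_eq_linear (I := 𝓘(ℝ, EN)) L.toHomeomorph L hIf
  haveI : IsManifold 𝓘(ℝ, EuclideanSpace ℝ (Fin (Module.finrank ℝ EN))) ∞
      (Rechart L.toHomeomorph (InteriorManifold IN N)) :=
    Rechart.isManifold L.toHomeomorph (InteriorManifold IN N) hL hL'
  let Θ : N ≃ₜ Rechart L.toHomeomorph (InteriorManifold IN N) :=
    Φ.trans (Rechart.outHomeomorph L.toHomeomorph (InteriorManifold IN N)).symm
  -- ### openness of homotopy classes in the recharted copy, transported back along `Θ`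
  have hev := eventually_homotopic_of_chartedSpace_euclideanSpace
    (n := Module.finrank ℝ EN) ((Θ : C(N, Rechart L.toHomeomorph (InteriorManifold IN N))).comp f)
  have hcont : Continuous fun ψ : C(X, N) ↦
      (Θ : C(N, Rechart L.toHomeomorph (InteriorManifold IN N))).comp ψ :=
    ContinuousMap.continuous_postcomp _
  filter_upwards [(hcont.tendsto f).eventually hev] with ψ hψ
  have hcomp := (ContinuousMap.Homotopic.refl
    (Θ.symm : C(Rechart L.toHomeomorph (InteriorManifold IN N), N))).comp hψ
  rwa [← ContinuousMap.comp_assoc, ← ContinuousMap.comp_assoc,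
    Homeomorph.symm_comp_toContinuousMap, ContinuousMap.id_comp, ContinuousMap.id_comp] at hcomp

/-- **A limit of maps homotopic to `f` is homotopic to `f`** (homotopy classes are closed under
limits in `C(X, N)`, `X` compact, `N` a compact manifold without boundary): if `F i → φ` in
`C(X, N)` along a nontrivial filter and every `F i` is homotopic to `f`, then `φ` is homotopic to
`f` (`eventually_homotopic` at `φ`). This is the step by which a convergent flow or approximation
scheme yields a map in the prescribed homotopy class. [cite: LeeSmoothManifolds2013, Prop. 6.25] -/
theorem _root_.ContinuousMap.Homotopic.of_tendsto
    {X : Type*} [TopologicalSpace X] [CompactSpace X]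
    {EN HN : Type*} [NormedAddCommGroup EN] [NormedSpace ℝ EN] [FiniteDimensional ℝ EN]
    [TopologicalSpace HN] {IN : ModelWithCorners ℝ EN HN} {N : Type*} [TopologicalSpace N]
    [ChartedSpace HN N] [IsManifold IN ∞ N] [BoundarylessManifold IN N] [CompactSpace N]
    [T2Space N] {ι : Type*} {l : Filter ι} [l.NeBot] {F : ι → C(X, N)} {f φ : C(X, N)}
    (hF : ∀ i, (F i).Homotopic f) (hlim : Tendsto F l (𝓝 φ)) : φ.Homotopic f := by
  obtain ⟨i, hi⟩ := (hlim.eventually (eventually_homotopic (IN := IN) φ)).exists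
  exact hi.symm.trans (hF i)

end Literature.Geometry.Manifold

end
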